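import Summits.BirchSwinnertonDyer.BirchSwinnertonDyer.Theorems.KimAtThreeFineKatoHLogClauseD
import Summits.BirchSwinnertonDyer.BirchSwinnertonDyer.Theorems.KimAtThreeFineKatoPerFactorPartsSingle
import HarnessLib

/-!
# The part `hLogᵃ` (log-lattice with a unit-trace point + duality, on EVERY additive `t = 0` row) FROM clause (d)
# (kernel) and the displayed duality residual DUALINTᵃ — w2-acc4 gen 5's `KimAtThreeFineKatoHLog` with the two
# Kato-stratum binders `¬ 3 ∣ c₃` / `¬ 3 ∣ c_P` deleted (route W2 `KimAtThreeKolyvagin`, item 20398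
# `FineKatoTwoExpDefectThree`; cell `bsd-addord`, seat w2-acc3 gen 9; helper, `--supports 20398`)

HONEST FRAMING.  Chain under construction (this seat, gen 9): `20398 ⟸ hKlocᵃ ⟸ hKdefᵃ ⟸ hKatoV2ʷ ∧ hS5aᵃ ∧ hLogᵃ`
(twins of kim3 g14/g15 and w2-acc5 g5 with the stratum binders deleted; the ONE mathematical change is the
two-exponent rider at `ℚ₃`, `KimAtThreeFineKatoTwoExpRiderAssembly`).  **hLogᵃ** = per additive `t = 0` row, per
`hdual`-normalised line datum `d` at `ℚ₃`, per level `r` and place `w₀ ∣ 3` of `L = ℚ(ζ_{cycLevel 3 0 r})`: (d) a set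
`Λ₀ ⊆ 𝒪_{w₀} ∋ 0` with ONE element of unit trace, and (e) `‖e₃⁻¹ Tr_{L_{w₀}/ℚ_v}(exp*_{d_w} z · ℓ)‖ ≤ 1` for every
(RES)-compatible line datum `d_w` at `L_{w₀}`, every `z ∈ H¹(L_{w₀}, T)` and every `ℓ ∈ Λ₀`.  THIS FILE proves
**`perFactorLog_of_dualInt : hDualTameᵃ → hDualWildᵃ → hLogᵃ`** exactly as w2-acc4 did: clause (d) is KERNEL at every
level from `Addv W 3` and `#E(ℚ₃)[3] = 1` alone (the unit-trace point of `E₀(K_{w₀})`: w2-kport `clause_d_unit_package`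
/ `consumer_of_addv`, kim3's (δ) — NO `c₃`, NO `c_P`), TAME levels at `w₀`, WILD levels over the unramified subfield
completion (road (R-b)); the two DISPLAYED hypotheses are clause (e) for THESE sets and follow from (S5b-tower) in
the sibling `KimAtThreeFineKatoTwoExpHLogFinal` (through this seat's c₃-free `dualInt_of_towerFact`).

TOOL theorem only (no definition, no named fact, no `sorry`); closes nothing by itself; nothing booked; BSD / 20398
are NOT proved by any of this.  `maxHeartbeats 800000` on the one theorem, as in the original (three displayed
packages with `letI`/`haveI` instance terms in one signature).

References: S. Bloch, K. Kato (1990) §3 Prop. 3.8, Ex. 3.11 [BlochKato1990]; K. Kato, LNM 1553 (1993) Ch. II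
§1.2, Thm. 1.4.1 [Kato1993LNM1553]; J. H. Silverman, *AEC* (2009) IV.6.4, VII.2 [SilvermanAEC2009];
J. Neukirch, *Algebraic Number Theory* (1999) Ch. II (7.12)–(7.13) [NeukirchANT1999]; kim3 memo KIM3-W2-C1c-SEMILOCAL-g14 §7–§8.
-/

noncomputable section

-- the cell's Theorems namespace `Summit.BirchSwinnertonDyer.BirchSwinnertonDyer.…` repeats the summit name by design (D-0017)
set_option linter.dupNamespace false

open scoped Classical NumberField TensorProduct ContRepresentation Pointwise
open Field ValuativeRel Function IsDedekindDomain NumberField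
open WeierstrassCurve Literature.NumberTheory.EllipticCurves Literature.NumberTheory.GaloisRepresentations
  Literature.NumberTheory.GaloisRepresentations.DiscreteGaloisModule Literature.NumberTheory.GaloisCohomology
open Literature.NumberTheory.GaloisRepresentations.PeriodRingData Literature.NumberTheory.PAdicHodge
open Literature.NumberTheory.EllipticCurves.ModularForms Literature.NumberTheory.EllipticCurves.Rank1Residual
open Literature.NumberTheory.EllipticCurves.Kato2004 Literature.NumberTheory.EllipticCurves.Kato2004.EulerSystemValues
open Literature.NumberTheory.AdelicBaseChange Literature.NumberTheory.Automorphic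
open Summit.BirchSwinnertonDyer.Rank1Residual.GaloisImage
open Summit.BirchSwinnertonDyer.Rank1Residual.Additive Summit.BirchSwinnertonDyer.Rank1Residual.Additive.BallEval
open Summit.BirchSwinnertonDyer.Rank1Residual.Additive.LocalLog
open Summit.BirchSwinnertonDyer.BirchSwinnertonDyer.Theorems
open Summit.BirchSwinnertonDyer.BirchSwinnertonDyer.Theorems.KPort
open Summit.BirchSwinnertonDyer.BirchSwinnertonDyer.Theorems.KimAtThreeFineKatoPerFactorDefined
open Summit.BirchSwinnertonDyer.BirchSwinnertonDyer.Theorems.KimAtThreeDeepLowerExpStarOmega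
open Summit.BirchSwinnertonDyer.BirchSwinnertonDyer.Theorems.KimAtThreeDeepLowerExpStarOmegaPlace
open Summit.BirchSwinnertonDyer.BirchSwinnertonDyer.Theorems.KimAtThreeFineKatoPerFactorPlaces

namespace Summit.BirchSwinnertonDyer.BirchSwinnertonDyer.Theorems.KimAtThreeFineKatoTwoExpHLog

set_option maxHeartbeats 800000 in
/-- **`hLogᵃ` from DUALINTᵃ** — w2-acc4 gen 5's `perFactorLog_of_dualInt` on EVERY additive `t = 0` row: the
displayed hypotheses hDualTameᵃ / hDualWildᵃ and the conclusion hLogᵃ are hDualTame / hDualWild / hLog₀ VERBATIM with the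
two Kato-stratum binder lines `¬ 3 ∣ c₃ →`, `¬ 3 ∣ c_P →` deleted; the proof is unchanged (clause (d) of hLog is
KERNEL at every level from `Addv W 3` and `#E(ℚ₃)[3] = 1` ALONE — tame: w2-kport's `clause_d_unit_package_tame'` at
`w₀`; wild: road (R-b) `clause_d_unit_package_wild'` over the unramified subfield — and clause (e) is supplied by
the two displayed duality-integrality hypotheses for exactly those sets).  Credit: w2-acc4 gen 5, w2-kport.
[cite: BlochKato1990, §3 Prop. 3.8 and Example 3.11] [cite: Kato1993LNM1553, Ch. II §1.2.4 and Thm. 1.4.1]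
[cite: SilvermanAEC2009, IV.6.4 and VII.2 Prop. 2.1–2.2] -/
theorem perFactorLog_of_dualInt
    (hDualTame : ∀ (W : WeierstrassCurve ℚ) [W.IsElliptic] [W.IsGloballyMinimal]
      [ContinuousSMul ℤ_[3] (W.tateModule 3)] [Module.Free ℤ_[3] (W.tateModule 3)]
      [Module.Finite ℤ_[3] (W.tateModule 3)],
      (∀ m : ℕ, W.HasSurjectiveModNGaloisRep (3 ^ m : ℕ)) →
      (haveI : Fact (Nat.Prime 3) := ⟨Nat.prime_three⟩; Addv W 3) →
      Nat.card {Q : (W.baseChange ℚ_[3]).toAffine.Point // (3 : ℕ) • Q = 0} = 1 →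
      ∀ {N : ℕ} [NeZero N] (P : ModularParametrizationData W N), N = W.conductorNorm ℤ →
        (∀ z ∈ P.L.lattice, ∃ w ∈ periodLattice P.f, z = P.c * w) →
        haveI : Fact (((3 : ℕ) : 𝓞 ℚ) ∈ ((Rat.HeightOneSpectrum.primesEquiv (R := 𝓞 ℚ)).symm ⟨3, Fact.out⟩).asIdeal) :=
          ⟨(natCast_mem_asIdeal_iff_eq_primesEquiv_symm _ Nat.prime_three).mpr rfl⟩
        letI := valuativeRelPlace ((Rat.HeightOneSpectrum.primesEquiv (R := 𝓞 ℚ)).symm ⟨3, Fact.out⟩)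
        letI := topologicalSpacePlace ((Rat.HeightOneSpectrum.primesEquiv (R := 𝓞 ℚ)).symm ⟨3, Fact.out⟩)
        haveI := isNonarchimedeanLocalField_place ((Rat.HeightOneSpectrum.primesEquiv (R := 𝓞 ℚ)).symm ⟨3, Fact.out⟩)
        haveI := charZero_place ((Rat.HeightOneSpectrum.primesEquiv (R := 𝓞 ℚ)).symm ⟨3, Fact.out⟩)
        letI := padicAlgebraPlace 3 ((Rat.HeightOneSpectrum.primesEquiv (R := 𝓞 ℚ)).symm ⟨3, Fact.out⟩)
        haveI := fact_not_isUnit_place 3 ((Rat.HeightOneSpectrum.primesEquiv (R := 𝓞 ℚ)).symm ⟨3, Fact.out⟩)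
        haveI := isAdicComplete_place 3 ((Rat.HeightOneSpectrum.primesEquiv (R := 𝓞 ℚ)).symm ⟨3, Fact.out⟩)
        ∀ (d : LocalNeronLineAt W 3 ((Rat.HeightOneSpectrum.primesEquiv (R := 𝓞 ℚ)).symm ⟨3, Fact.out⟩))
          (hinj : (bdRPeriodRingData (valuation_place_lt_one 3 ((Rat.HeightOneSpectrum.primesEquiv (R := 𝓞 ℚ)).symm ⟨3, Fact.out⟩))).CupLogInjective (logCyclotomic 3)
            (localRationalTateRep W 3 (galRestrictPlace ((Rat.HeightOneSpectrum.primesEquiv (R := 𝓞 ℚ)).symm ⟨3, Fact.out⟩))))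
          (hex : ∀ z : contOneCocycles (localRationalTateRep W 3 (galRestrictPlace ((Rat.HeightOneSpectrum.primesEquiv (R := 𝓞 ℚ)).symm ⟨3, Fact.out⟩))).toTopRep,
            (bdRPeriodRingData (valuation_place_lt_one 3 ((Rat.HeightOneSpectrum.primesEquiv (R := 𝓞 ℚ)).symm ⟨3, Fact.out⟩))).HasDualExp (logCyclotomic 3)
              (localRationalTateRep W 3 (galRestrictPlace ((Rat.HeightOneSpectrum.primesEquiv (R := 𝓞 ℚ)).symm ⟨3, Fact.out⟩))) fun σ => z.1 σ),
          (∀ a : ℚ_[3], (∃ y, (expStarOmegaPadicAt d hinj hex (((Padic.adicCompletionEquiv (𝓞 ℚ) ⟨3, Fact.out⟩).symm : (((Rat.HeightOneSpectrum.primesEquiv (R := 𝓞 ℚ)).symm ⟨3, Fact.out⟩).adicCompletion ℚ) →+* ℚ_[3]))) y = a) ↔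
            ∀ Q : (W.baseChange ℚ_[3]).toAffine.Point, ‖a * padicLog (W.baseChange ℚ_[3]) Q‖ ≤ 1) →
          ∀ (r : Finset (HeightOneSpectrum (𝓞 ℚ)))
            (w₀ : ((Rat.HeightOneSpectrum.primesEquiv (R := 𝓞 ℚ)).symm ⟨3, Fact.out⟩).Extension
              (𝓞 (CyclotomicField (cycLevel 3 0 r) ℚ))),
            letI := LocalField.charZero_adicCompletion w₀.1
            letI := LocalField.adicCompletionPadicAlgebra w₀.1 3 (three_mem_asIdeal_extension _ w₀)
            haveI : Fact (¬ IsUnit ((3 : ℕ) : integerC (w₀.1.adicCompletion (CyclotomicField (cycLevel 3 0 r) ℚ)))) :=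
              ⟨not_isUnit_natCast_integerC (LocalField.valuation_adicCompletion_natCast_lt_one w₀.1 3 (three_mem_asIdeal_extension _ w₀))⟩
            haveI := isAdicComplete_integerC_natCast (LocalField.valuation_adicCompletion_natCast_lt_one w₀.1 3 (three_mem_asIdeal_extension _ w₀))
            ∀ (he : w₀.1.asIdeal.ramificationIdx (𝓞 ℚ) = 1),
            haveI : Fact (w₀.1.asIdeal.ramificationIdx (𝓞 ℚ) = 1) := ⟨he⟩
            haveI := isIntegral_curveK 3 (Kw 3 (CyclotomicField (cycLevel 3 0 r) ℚ) w₀) ((integralModelInt W).map (Int.castRingHom ℤ_[3]))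
              ∀ (dw : LocalNeronLine W (LocalField.valuation_adicCompletion_natCast_lt_one w₀.1 3 (three_mem_asIdeal_extension _ w₀))
                  ((galRestrictPlace ((Rat.HeightOneSpectrum.primesEquiv (R := 𝓞 ℚ)).symm ⟨3, Fact.out⟩)).comp
                    (absGaloisRestrict (((Rat.HeightOneSpectrum.primesEquiv (R := 𝓞 ℚ)).symm ⟨3, Fact.out⟩).adicCompletion ℚ) (w₀.1.adicCompletion (CyclotomicField (cycLevel 3 0 r) ℚ)))))
                  (hinjw : (bdRPeriodRingData (LocalField.valuation_adicCompletion_natCast_lt_one w₀.1 3 (three_mem_asIdeal_extension _ w₀))).CupLogInjective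
                  (logCyclotomic 3) (localRationalTateRep W 3 ((galRestrictPlace ((Rat.HeightOneSpectrum.primesEquiv (R := 𝓞 ℚ)).symm ⟨3, Fact.out⟩)).comp
                    (absGaloisRestrict (((Rat.HeightOneSpectrum.primesEquiv (R := 𝓞 ℚ)).symm ⟨3, Fact.out⟩).adicCompletion ℚ) (w₀.1.adicCompletion (CyclotomicField (cycLevel 3 0 r) ℚ))))))
                  (hexw : ∀ z : contOneCocycles (localRationalTateRep W 3 ((galRestrictPlace ((Rat.HeightOneSpectrum.primesEquiv (R := 𝓞 ℚ)).symm ⟨3, Fact.out⟩)).comp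
                    (absGaloisRestrict (((Rat.HeightOneSpectrum.primesEquiv (R := 𝓞 ℚ)).symm ⟨3, Fact.out⟩).adicCompletion ℚ) (w₀.1.adicCompletion (CyclotomicField (cycLevel 3 0 r) ℚ))))).toTopRep,
                  (bdRPeriodRingData (LocalField.valuation_adicCompletion_natCast_lt_one w₀.1 3 (three_mem_asIdeal_extension _ w₀))).HasDualExp
                    (logCyclotomic 3) (localRationalTateRep W 3 ((galRestrictPlace ((Rat.HeightOneSpectrum.primesEquiv (R := 𝓞 ℚ)).symm ⟨3, Fact.out⟩)).comp
                    (absGaloisRestrict (((Rat.HeightOneSpectrum.primesEquiv (R := 𝓞 ℚ)).symm ⟨3, Fact.out⟩).adicCompletion ℚ) (w₀.1.adicCompletion (CyclotomicField (cycLevel 3 0 r) ℚ))))) fun σ => z.1 σ),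
                  (∀ (h : (tateLocalRep W 3 (Sum.inr ((Rat.HeightOneSpectrum.primesEquiv (R := 𝓞 ℚ)).symm ⟨3, Fact.out⟩))).cohomology 1),
                  (expStarOmegaHom (LocalField.valuation_adicCompletion_natCast_lt_one w₀.1 3 (three_mem_asIdeal_extension _ w₀))
                    ((galRestrictPlace ((Rat.HeightOneSpectrum.primesEquiv (R := 𝓞 ℚ)).symm ⟨3, Fact.out⟩)).comp
                    (absGaloisRestrict (((Rat.HeightOneSpectrum.primesEquiv (R := 𝓞 ℚ)).symm ⟨3, Fact.out⟩).adicCompletion ℚ) (w₀.1.adicCompletion (CyclotomicField (cycLevel 3 0 r) ℚ)))) dw hinjw hexw)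
                    (ContinuousRep.cohomologyRes (tateLocalRep W 3 (Sum.inr ((Rat.HeightOneSpectrum.primesEquiv (R := 𝓞 ℚ)).symm ⟨3, Fact.out⟩)))
                      (absGaloisRestrict (((Rat.HeightOneSpectrum.primesEquiv (R := 𝓞 ℚ)).symm ⟨3, Fact.out⟩).adicCompletion ℚ) (w₀.1.adicCompletion (CyclotomicField (cycLevel 3 0 r) ℚ))) 1 h) =
                  algebraMap (((Rat.HeightOneSpectrum.primesEquiv (R := 𝓞 ℚ)).symm ⟨3, Fact.out⟩).adicCompletion ℚ) (w₀.1.adicCompletion (CyclotomicField (cycLevel 3 0 r) ℚ)) (expStarOmegaAt d h)) →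
                  ∀ z, ∀ P ∈ (((integralModelInt W).map (Int.castRingHom ℤ_[3])).map (coeffHom 3 (Kw 3 (CyclotomicField (cycLevel 3 0 r) ℚ) w₀))).nonsingularReductionSubgroup (Valuation.integer.integers (NormedField.valuation (K := Kw 3 (CyclotomicField (cycLevel 3 0 r) ℚ) w₀))), ‖(Padic.adicCompletionEquiv (𝓞 ℚ) ⟨3, Fact.out⟩).symm
                    (Algebra.trace (((Rat.HeightOneSpectrum.primesEquiv (R := 𝓞 ℚ)).symm ⟨3, Fact.out⟩).adicCompletion ℚ)
                      (w₀.1.adicCompletion (CyclotomicField (cycLevel 3 0 r) ℚ)) ((expStarOmegaHom (LocalField.valuation_adicCompletion_natCast_lt_one w₀.1 3 (three_mem_asIdeal_extension _ w₀))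
                    ((galRestrictPlace ((Rat.HeightOneSpectrum.primesEquiv (R := 𝓞 ℚ)).symm ⟨3, Fact.out⟩)).comp
                    (absGaloisRestrict (((Rat.HeightOneSpectrum.primesEquiv (R := 𝓞 ℚ)).symm ⟨3, Fact.out⟩).adicCompletion ℚ) (w₀.1.adicCompletion (CyclotomicField (cycLevel 3 0 r) ℚ)))) dw hinjw hexw) z * Kw.toCompletion 3 (CyclotomicField (cycLevel 3 0 r) ℚ) w₀ (satLog 3 (Kw 3 (CyclotomicField (cycLevel 3 0 r) ℚ) w₀) ((integralModelInt W).map (Int.castRingHom ℤ_[3])) P)))‖ ≤ 1)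
    (hDualWild : ∀ (W : WeierstrassCurve ℚ) [W.IsElliptic] [W.IsGloballyMinimal]
      [ContinuousSMul ℤ_[3] (W.tateModule 3)] [Module.Free ℤ_[3] (W.tateModule 3)]
      [Module.Finite ℤ_[3] (W.tateModule 3)],
      (∀ m : ℕ, W.HasSurjectiveModNGaloisRep (3 ^ m : ℕ)) →
      (haveI : Fact (Nat.Prime 3) := ⟨Nat.prime_three⟩; Addv W 3) →
      Nat.card {Q : (W.baseChange ℚ_[3]).toAffine.Point // (3 : ℕ) • Q = 0} = 1 →
      ∀ {N : ℕ} [NeZero N] (P : ModularParametrizationData W N), N = W.conductorNorm ℤ →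
        (∀ z ∈ P.L.lattice, ∃ w ∈ periodLattice P.f, z = P.c * w) →
        haveI : Fact (((3 : ℕ) : 𝓞 ℚ) ∈ ((Rat.HeightOneSpectrum.primesEquiv (R := 𝓞 ℚ)).symm ⟨3, Fact.out⟩).asIdeal) :=
          ⟨(natCast_mem_asIdeal_iff_eq_primesEquiv_symm _ Nat.prime_three).mpr rfl⟩
        letI := valuativeRelPlace ((Rat.HeightOneSpectrum.primesEquiv (R := 𝓞 ℚ)).symm ⟨3, Fact.out⟩)
        letI := topologicalSpacePlace ((Rat.HeightOneSpectrum.primesEquiv (R := 𝓞 ℚ)).symm ⟨3, Fact.out⟩)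
        haveI := isNonarchimedeanLocalField_place ((Rat.HeightOneSpectrum.primesEquiv (R := 𝓞 ℚ)).symm ⟨3, Fact.out⟩)
        haveI := charZero_place ((Rat.HeightOneSpectrum.primesEquiv (R := 𝓞 ℚ)).symm ⟨3, Fact.out⟩)
        letI := padicAlgebraPlace 3 ((Rat.HeightOneSpectrum.primesEquiv (R := 𝓞 ℚ)).symm ⟨3, Fact.out⟩)
        haveI := fact_not_isUnit_place 3 ((Rat.HeightOneSpectrum.primesEquiv (R := 𝓞 ℚ)).symm ⟨3, Fact.out⟩)
        haveI := isAdicComplete_place 3 ((Rat.HeightOneSpectrum.primesEquiv (R := 𝓞 ℚ)).symm ⟨3, Fact.out⟩)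
        ∀ (d : LocalNeronLineAt W 3 ((Rat.HeightOneSpectrum.primesEquiv (R := 𝓞 ℚ)).symm ⟨3, Fact.out⟩))
          (hinj : (bdRPeriodRingData (valuation_place_lt_one 3 ((Rat.HeightOneSpectrum.primesEquiv (R := 𝓞 ℚ)).symm ⟨3, Fact.out⟩))).CupLogInjective (logCyclotomic 3)
            (localRationalTateRep W 3 (galRestrictPlace ((Rat.HeightOneSpectrum.primesEquiv (R := 𝓞 ℚ)).symm ⟨3, Fact.out⟩))))
          (hex : ∀ z : contOneCocycles (localRationalTateRep W 3 (galRestrictPlace ((Rat.HeightOneSpectrum.primesEquiv (R := 𝓞 ℚ)).symm ⟨3, Fact.out⟩))).toTopRep,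
            (bdRPeriodRingData (valuation_place_lt_one 3 ((Rat.HeightOneSpectrum.primesEquiv (R := 𝓞 ℚ)).symm ⟨3, Fact.out⟩))).HasDualExp (logCyclotomic 3)
              (localRationalTateRep W 3 (galRestrictPlace ((Rat.HeightOneSpectrum.primesEquiv (R := 𝓞 ℚ)).symm ⟨3, Fact.out⟩))) fun σ => z.1 σ),
          (∀ a : ℚ_[3], (∃ y, (expStarOmegaPadicAt d hinj hex (((Padic.adicCompletionEquiv (𝓞 ℚ) ⟨3, Fact.out⟩).symm : (((Rat.HeightOneSpectrum.primesEquiv (R := 𝓞 ℚ)).symm ⟨3, Fact.out⟩).adicCompletion ℚ) →+* ℚ_[3]))) y = a) ↔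
            ∀ Q : (W.baseChange ℚ_[3]).toAffine.Point, ‖a * padicLog (W.baseChange ℚ_[3]) Q‖ ≤ 1) →
          ∀ (r : Finset (HeightOneSpectrum (𝓞 ℚ)))
            (w₀ : ((Rat.HeightOneSpectrum.primesEquiv (R := 𝓞 ℚ)).symm ⟨3, Fact.out⟩).Extension
              (𝓞 (CyclotomicField (cycLevel 3 0 r) ℚ))),
            letI := LocalField.charZero_adicCompletion w₀.1
            letI := LocalField.adicCompletionPadicAlgebra w₀.1 3 (three_mem_asIdeal_extension _ w₀)
            haveI : Fact (¬ IsUnit ((3 : ℕ) : integerC (w₀.1.adicCompletion (CyclotomicField (cycLevel 3 0 r) ℚ)))) :=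
              ⟨not_isUnit_natCast_integerC (LocalField.valuation_adicCompletion_natCast_lt_one w₀.1 3 (three_mem_asIdeal_extension _ w₀))⟩
            haveI := isAdicComplete_integerC_natCast (LocalField.valuation_adicCompletion_natCast_lt_one w₀.1 3 (three_mem_asIdeal_extension _ w₀))
            ∀ (F : IntermediateField ℚ (CyclotomicField (cycLevel 3 0 r) ℚ))
              (u : ((Rat.HeightOneSpectrum.primesEquiv (R := 𝓞 ℚ)).symm ⟨3, Fact.out⟩).Extension (𝓞 F))
              (hwu : w₀.1.under (𝓞 F) = u.1) (he : u.1.asIdeal.ramificationIdx (𝓞 ℚ) = 1),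
            haveI : Fact (u.1.asIdeal.ramificationIdx (𝓞 ℚ) = 1) := ⟨he⟩
            haveI := isIntegral_curveK 3 (Kw 3 F u) ((integralModelInt W).map (Int.castRingHom ℤ_[3]))
              ∀ (dw : LocalNeronLine W (LocalField.valuation_adicCompletion_natCast_lt_one w₀.1 3 (three_mem_asIdeal_extension _ w₀))
                  ((galRestrictPlace ((Rat.HeightOneSpectrum.primesEquiv (R := 𝓞 ℚ)).symm ⟨3, Fact.out⟩)).comp
                    (absGaloisRestrict (((Rat.HeightOneSpectrum.primesEquiv (R := 𝓞 ℚ)).symm ⟨3, Fact.out⟩).adicCompletion ℚ) (w₀.1.adicCompletion (CyclotomicField (cycLevel 3 0 r) ℚ)))))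
                  (hinjw : (bdRPeriodRingData (LocalField.valuation_adicCompletion_natCast_lt_one w₀.1 3 (three_mem_asIdeal_extension _ w₀))).CupLogInjective
                  (logCyclotomic 3) (localRationalTateRep W 3 ((galRestrictPlace ((Rat.HeightOneSpectrum.primesEquiv (R := 𝓞 ℚ)).symm ⟨3, Fact.out⟩)).comp
                    (absGaloisRestrict (((Rat.HeightOneSpectrum.primesEquiv (R := 𝓞 ℚ)).symm ⟨3, Fact.out⟩).adicCompletion ℚ) (w₀.1.adicCompletion (CyclotomicField (cycLevel 3 0 r) ℚ))))))
                  (hexw : ∀ z : contOneCocycles (localRationalTateRep W 3 ((galRestrictPlace ((Rat.HeightOneSpectrum.primesEquiv (R := 𝓞 ℚ)).symm ⟨3, Fact.out⟩)).comp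
                    (absGaloisRestrict (((Rat.HeightOneSpectrum.primesEquiv (R := 𝓞 ℚ)).symm ⟨3, Fact.out⟩).adicCompletion ℚ) (w₀.1.adicCompletion (CyclotomicField (cycLevel 3 0 r) ℚ))))).toTopRep,
                  (bdRPeriodRingData (LocalField.valuation_adicCompletion_natCast_lt_one w₀.1 3 (three_mem_asIdeal_extension _ w₀))).HasDualExp
                    (logCyclotomic 3) (localRationalTateRep W 3 ((galRestrictPlace ((Rat.HeightOneSpectrum.primesEquiv (R := 𝓞 ℚ)).symm ⟨3, Fact.out⟩)).comp
                    (absGaloisRestrict (((Rat.HeightOneSpectrum.primesEquiv (R := 𝓞 ℚ)).symm ⟨3, Fact.out⟩).adicCompletion ℚ) (w₀.1.adicCompletion (CyclotomicField (cycLevel 3 0 r) ℚ))))) fun σ => z.1 σ),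
                  (∀ (h : (tateLocalRep W 3 (Sum.inr ((Rat.HeightOneSpectrum.primesEquiv (R := 𝓞 ℚ)).symm ⟨3, Fact.out⟩))).cohomology 1),
                  (expStarOmegaHom (LocalField.valuation_adicCompletion_natCast_lt_one w₀.1 3 (three_mem_asIdeal_extension _ w₀))
                    ((galRestrictPlace ((Rat.HeightOneSpectrum.primesEquiv (R := 𝓞 ℚ)).symm ⟨3, Fact.out⟩)).comp
                    (absGaloisRestrict (((Rat.HeightOneSpectrum.primesEquiv (R := 𝓞 ℚ)).symm ⟨3, Fact.out⟩).adicCompletion ℚ) (w₀.1.adicCompletion (CyclotomicField (cycLevel 3 0 r) ℚ)))) dw hinjw hexw)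
                    (ContinuousRep.cohomologyRes (tateLocalRep W 3 (Sum.inr ((Rat.HeightOneSpectrum.primesEquiv (R := 𝓞 ℚ)).symm ⟨3, Fact.out⟩)))
                      (absGaloisRestrict (((Rat.HeightOneSpectrum.primesEquiv (R := 𝓞 ℚ)).symm ⟨3, Fact.out⟩).adicCompletion ℚ) (w₀.1.adicCompletion (CyclotomicField (cycLevel 3 0 r) ℚ))) 1 h) =
                  algebraMap (((Rat.HeightOneSpectrum.primesEquiv (R := 𝓞 ℚ)).symm ⟨3, Fact.out⟩).adicCompletion ℚ) (w₀.1.adicCompletion (CyclotomicField (cycLevel 3 0 r) ℚ)) (expStarOmegaAt d h)) →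
                  ∀ z, ∀ P ∈ (((integralModelInt W).map (Int.castRingHom ℤ_[3])).map (coeffHom 3 (Kw 3 F u))).nonsingularReductionSubgroup (Valuation.integer.integers (NormedField.valuation (K := Kw 3 F u))), ‖(Padic.adicCompletionEquiv (𝓞 ℚ) ⟨3, Fact.out⟩).symm
                    (Algebra.trace (((Rat.HeightOneSpectrum.primesEquiv (R := 𝓞 ℚ)).symm ⟨3, Fact.out⟩).adicCompletion ℚ)
                      (w₀.1.adicCompletion (CyclotomicField (cycLevel 3 0 r) ℚ)) ((expStarOmegaHom (LocalField.valuation_adicCompletion_natCast_lt_one w₀.1 3 (three_mem_asIdeal_extension _ w₀))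
                    ((galRestrictPlace ((Rat.HeightOneSpectrum.primesEquiv (R := 𝓞 ℚ)).symm ⟨3, Fact.out⟩)).comp
                    (absGaloisRestrict (((Rat.HeightOneSpectrum.primesEquiv (R := 𝓞 ℚ)).symm ⟨3, Fact.out⟩).adicCompletion ℚ) (w₀.1.adicCompletion (CyclotomicField (cycLevel 3 0 r) ℚ)))) dw hinjw hexw) z * HeightOneSpectrum.Extension.adicCompletionSemialgHom F (CyclotomicField (cycLevel 3 0 r) ℚ) (⟨w₀.1, hwu⟩ : u.1.Extension (𝓞 (CyclotomicField (cycLevel 3 0 r) ℚ))) (Kw.toCompletion 3 F u (satLog 3 (Kw 3 F u) ((integralModelInt W).map (Int.castRingHom ℤ_[3])) P))))‖ ≤ 1) :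
    ∀ (W : WeierstrassCurve ℚ) [W.IsElliptic] [W.IsGloballyMinimal]
      [ContinuousSMul ℤ_[3] (W.tateModule 3)] [Module.Free ℤ_[3] (W.tateModule 3)]
      [Module.Finite ℤ_[3] (W.tateModule 3)],
      (∀ m : ℕ, W.HasSurjectiveModNGaloisRep (3 ^ m : ℕ)) →
      (haveI : Fact (Nat.Prime 3) := ⟨Nat.prime_three⟩; Addv W 3) →
      Nat.card {Q : (W.baseChange ℚ_[3]).toAffine.Point // (3 : ℕ) • Q = 0} = 1 →
      ∀ {N : ℕ} [NeZero N] (P : ModularParametrizationData W N), N = W.conductorNorm ℤ →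
        (∀ z ∈ P.L.lattice, ∃ w ∈ periodLattice P.f, z = P.c * w) →
        haveI : Fact (((3 : ℕ) : 𝓞 ℚ) ∈ ((Rat.HeightOneSpectrum.primesEquiv (R := 𝓞 ℚ)).symm ⟨3, Fact.out⟩).asIdeal) :=
          ⟨(natCast_mem_asIdeal_iff_eq_primesEquiv_symm _ Nat.prime_three).mpr rfl⟩
        letI := valuativeRelPlace ((Rat.HeightOneSpectrum.primesEquiv (R := 𝓞 ℚ)).symm ⟨3, Fact.out⟩)
        letI := topologicalSpacePlace ((Rat.HeightOneSpectrum.primesEquiv (R := 𝓞 ℚ)).symm ⟨3, Fact.out⟩)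
        haveI := isNonarchimedeanLocalField_place ((Rat.HeightOneSpectrum.primesEquiv (R := 𝓞 ℚ)).symm ⟨3, Fact.out⟩)
        haveI := charZero_place ((Rat.HeightOneSpectrum.primesEquiv (R := 𝓞 ℚ)).symm ⟨3, Fact.out⟩)
        letI := padicAlgebraPlace 3 ((Rat.HeightOneSpectrum.primesEquiv (R := 𝓞 ℚ)).symm ⟨3, Fact.out⟩)
        haveI := fact_not_isUnit_place 3 ((Rat.HeightOneSpectrum.primesEquiv (R := 𝓞 ℚ)).symm ⟨3, Fact.out⟩)
        haveI := isAdicComplete_place 3 ((Rat.HeightOneSpectrum.primesEquiv (R := 𝓞 ℚ)).symm ⟨3, Fact.out⟩)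
        ∀ (d : LocalNeronLineAt W 3 ((Rat.HeightOneSpectrum.primesEquiv (R := 𝓞 ℚ)).symm ⟨3, Fact.out⟩))
          (hinj : (bdRPeriodRingData (valuation_place_lt_one 3 ((Rat.HeightOneSpectrum.primesEquiv (R := 𝓞 ℚ)).symm ⟨3, Fact.out⟩))).CupLogInjective (logCyclotomic 3)
            (localRationalTateRep W 3 (galRestrictPlace ((Rat.HeightOneSpectrum.primesEquiv (R := 𝓞 ℚ)).symm ⟨3, Fact.out⟩))))
          (hex : ∀ z : contOneCocycles (localRationalTateRep W 3 (galRestrictPlace ((Rat.HeightOneSpectrum.primesEquiv (R := 𝓞 ℚ)).symm ⟨3, Fact.out⟩))).toTopRep,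
            (bdRPeriodRingData (valuation_place_lt_one 3 ((Rat.HeightOneSpectrum.primesEquiv (R := 𝓞 ℚ)).symm ⟨3, Fact.out⟩))).HasDualExp (logCyclotomic 3)
              (localRationalTateRep W 3 (galRestrictPlace ((Rat.HeightOneSpectrum.primesEquiv (R := 𝓞 ℚ)).symm ⟨3, Fact.out⟩))) fun σ => z.1 σ),
          (∀ a : ℚ_[3], (∃ y, (expStarOmegaPadicAt d hinj hex (((Padic.adicCompletionEquiv (𝓞 ℚ) ⟨3, Fact.out⟩).symm : (((Rat.HeightOneSpectrum.primesEquiv (R := 𝓞 ℚ)).symm ⟨3, Fact.out⟩).adicCompletion ℚ) →+* ℚ_[3]))) y = a) ↔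
            ∀ Q : (W.baseChange ℚ_[3]).toAffine.Point, ‖a * padicLog (W.baseChange ℚ_[3]) Q‖ ≤ 1) →
          ∀ (r : Finset (HeightOneSpectrum (𝓞 ℚ)))
            (w₀ : ((Rat.HeightOneSpectrum.primesEquiv (R := 𝓞 ℚ)).symm ⟨3, Fact.out⟩).Extension
              (𝓞 (CyclotomicField (cycLevel 3 0 r) ℚ))),
            letI := LocalField.charZero_adicCompletion w₀.1
            letI := LocalField.adicCompletionPadicAlgebra w₀.1 3 (three_mem_asIdeal_extension _ w₀)
            haveI : Fact (¬ IsUnit ((3 : ℕ) : integerC (w₀.1.adicCompletion (CyclotomicField (cycLevel 3 0 r) ℚ)))) :=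
              ⟨not_isUnit_natCast_integerC (LocalField.valuation_adicCompletion_natCast_lt_one w₀.1 3 (three_mem_asIdeal_extension _ w₀))⟩
            haveI := isAdicComplete_integerC_natCast (LocalField.valuation_adicCompletion_natCast_lt_one w₀.1 3 (three_mem_asIdeal_extension _ w₀))
            ∃ (Λ₀ : Set (w₀.1.adicCompletion (CyclotomicField (cycLevel 3 0 r) ℚ))),
              Λ₀ ⊆ w₀.1.adicCompletionIntegers (CyclotomicField (cycLevel 3 0 r) ℚ) ∧
              (0 : w₀.1.adicCompletion (CyclotomicField (cycLevel 3 0 r) ℚ)) ∈ Λ₀ ∧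
              (∃ ℓ₀ ∈ Λ₀, ‖(Padic.adicCompletionEquiv (𝓞 ℚ) ⟨3, Fact.out⟩).symm
                (Algebra.trace (((Rat.HeightOneSpectrum.primesEquiv (R := 𝓞 ℚ)).symm ⟨3, Fact.out⟩).adicCompletion ℚ)
                  (w₀.1.adicCompletion (CyclotomicField (cycLevel 3 0 r) ℚ)) ℓ₀)‖ = 1) ∧
              (∀ (dw : LocalNeronLine W (LocalField.valuation_adicCompletion_natCast_lt_one w₀.1 3 (three_mem_asIdeal_extension _ w₀))
                  ((galRestrictPlace ((Rat.HeightOneSpectrum.primesEquiv (R := 𝓞 ℚ)).symm ⟨3, Fact.out⟩)).comp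
                    (absGaloisRestrict (((Rat.HeightOneSpectrum.primesEquiv (R := 𝓞 ℚ)).symm ⟨3, Fact.out⟩).adicCompletion ℚ) (w₀.1.adicCompletion (CyclotomicField (cycLevel 3 0 r) ℚ)))))
                  (hinjw : (bdRPeriodRingData (LocalField.valuation_adicCompletion_natCast_lt_one w₀.1 3 (three_mem_asIdeal_extension _ w₀))).CupLogInjective
                  (logCyclotomic 3) (localRationalTateRep W 3 ((galRestrictPlace ((Rat.HeightOneSpectrum.primesEquiv (R := 𝓞 ℚ)).symm ⟨3, Fact.out⟩)).comp
                    (absGaloisRestrict (((Rat.HeightOneSpectrum.primesEquiv (R := 𝓞 ℚ)).symm ⟨3, Fact.out⟩).adicCompletion ℚ) (w₀.1.adicCompletion (CyclotomicField (cycLevel 3 0 r) ℚ))))))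
                  (hexw : ∀ z : contOneCocycles (localRationalTateRep W 3 ((galRestrictPlace ((Rat.HeightOneSpectrum.primesEquiv (R := 𝓞 ℚ)).symm ⟨3, Fact.out⟩)).comp
                    (absGaloisRestrict (((Rat.HeightOneSpectrum.primesEquiv (R := 𝓞 ℚ)).symm ⟨3, Fact.out⟩).adicCompletion ℚ) (w₀.1.adicCompletion (CyclotomicField (cycLevel 3 0 r) ℚ))))).toTopRep,
                  (bdRPeriodRingData (LocalField.valuation_adicCompletion_natCast_lt_one w₀.1 3 (three_mem_asIdeal_extension _ w₀))).HasDualExp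
                    (logCyclotomic 3) (localRationalTateRep W 3 ((galRestrictPlace ((Rat.HeightOneSpectrum.primesEquiv (R := 𝓞 ℚ)).symm ⟨3, Fact.out⟩)).comp
                    (absGaloisRestrict (((Rat.HeightOneSpectrum.primesEquiv (R := 𝓞 ℚ)).symm ⟨3, Fact.out⟩).adicCompletion ℚ) (w₀.1.adicCompletion (CyclotomicField (cycLevel 3 0 r) ℚ))))) fun σ => z.1 σ),
                  (∀ (h : (tateLocalRep W 3 (Sum.inr ((Rat.HeightOneSpectrum.primesEquiv (R := 𝓞 ℚ)).symm ⟨3, Fact.out⟩))).cohomology 1),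
                  (expStarOmegaHom (LocalField.valuation_adicCompletion_natCast_lt_one w₀.1 3 (three_mem_asIdeal_extension _ w₀))
                    ((galRestrictPlace ((Rat.HeightOneSpectrum.primesEquiv (R := 𝓞 ℚ)).symm ⟨3, Fact.out⟩)).comp
                    (absGaloisRestrict (((Rat.HeightOneSpectrum.primesEquiv (R := 𝓞 ℚ)).symm ⟨3, Fact.out⟩).adicCompletion ℚ) (w₀.1.adicCompletion (CyclotomicField (cycLevel 3 0 r) ℚ)))) dw hinjw hexw)
                    (ContinuousRep.cohomologyRes (tateLocalRep W 3 (Sum.inr ((Rat.HeightOneSpectrum.primesEquiv (R := 𝓞 ℚ)).symm ⟨3, Fact.out⟩)))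
                      (absGaloisRestrict (((Rat.HeightOneSpectrum.primesEquiv (R := 𝓞 ℚ)).symm ⟨3, Fact.out⟩).adicCompletion ℚ) (w₀.1.adicCompletion (CyclotomicField (cycLevel 3 0 r) ℚ))) 1 h) =
                  algebraMap (((Rat.HeightOneSpectrum.primesEquiv (R := 𝓞 ℚ)).symm ⟨3, Fact.out⟩).adicCompletion ℚ) (w₀.1.adicCompletion (CyclotomicField (cycLevel 3 0 r) ℚ)) (expStarOmegaAt d h)) →
                  ∀ z, ∀ ℓ ∈ Λ₀, ‖(Padic.adicCompletionEquiv (𝓞 ℚ) ⟨3, Fact.out⟩).symm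
                    (Algebra.trace (((Rat.HeightOneSpectrum.primesEquiv (R := 𝓞 ℚ)).symm ⟨3, Fact.out⟩).adicCompletion ℚ)
                      (w₀.1.adicCompletion (CyclotomicField (cycLevel 3 0 r) ℚ)) ((expStarOmegaHom (LocalField.valuation_adicCompletion_natCast_lt_one w₀.1 3 (three_mem_asIdeal_extension _ w₀))
                    ((galRestrictPlace ((Rat.HeightOneSpectrum.primesEquiv (R := 𝓞 ℚ)).symm ⟨3, Fact.out⟩)).comp
                    (absGaloisRestrict (((Rat.HeightOneSpectrum.primesEquiv (R := 𝓞 ℚ)).symm ⟨3, Fact.out⟩).adicCompletion ℚ) (w₀.1.adicCompletion (CyclotomicField (cycLevel 3 0 r) ℚ)))) dw hinjw hexw) z * ℓ))‖ ≤ 1) := by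
    -- the packages' row data
  intro W _ _ _ _ _ htow hadd ht N _ P hN hlat d hinj hex hdual r w₀
  by_cases hr : (Rat.HeightOneSpectrum.primesEquiv (R := 𝓞 ℚ)).symm ⟨3, Fact.out⟩ ∈ r
  · -- WILD level `m = 3·m′`: road (R-b)
    have hm3 := cycLevel_zero_eq_three_mul_erase hr
    have hm' := not_three_dvd_cycLevel_zero_erase r
    haveI : IsCyclotomicExtension {3 * cycLevel 3 0
        (r.erase ((Rat.HeightOneSpectrum.primesEquiv (R := 𝓞 ℚ)).symm ⟨3, Nat.prime_three⟩))} ℚ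
        (CyclotomicField (cycLevel 3 0 r) ℚ) :=
      hm3 ▸ CyclotomicField.isCyclotomicExtension (cycLevel 3 0 r) ℚ
    obtain ⟨F, hF⟩ := exists_intermediateField_isCyclotomicExtension (CyclotomicField (cycLevel 3 0 r) ℚ) 3
      (cycLevel 3 0 (r.erase ((Rat.HeightOneSpectrum.primesEquiv (R := 𝓞 ℚ)).symm ⟨3, Nat.prime_three⟩)))
    haveI := hF
    obtain ⟨u, hwu⟩ := exists_extension_under (F := F) _ w₀
    have he : u.1.asIdeal.ramificationIdx (𝓞 ℚ) = 1 :=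
      Kw.ramificationIdx_eq_one_of_isCyclotomicExtension (L := F) (w := u) (cycLevel 3 0 (r.erase ((Rat.HeightOneSpectrum.primesEquiv (R := 𝓞 ℚ)).symm ⟨3, Nat.prime_three⟩))) hm'
    obtain ⟨hsub, h0, hunit⟩ := clause_d_unit_package_wild' (cycLevel 3 0 (r.erase ((Rat.HeightOneSpectrum.primesEquiv (R := 𝓞 ℚ)).symm ⟨3, Nat.prime_three⟩))) hm' u w₀ hwu W hadd ht
    refine ⟨_, hsub, h0, hunit, ?_⟩
    intro dw hinjw hexw hresw z ℓ hℓ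
    obtain ⟨x, ⟨Q, hQ, rfl⟩, rfl⟩ := hℓ
    exact hDualWild W htow hadd ht P hN hlat d hinj hex hdual r w₀ F u hwu he dw hinjw hexw hresw z Q hQ
  · -- TAME level `3 ∤ m`: w2-kport's package at `w₀`
    have hm := not_three_dvd_cycLevel_zero hr
    haveI : IsCyclotomicExtension {cycLevel 3 0 r} ℚ (CyclotomicField (cycLevel 3 0 r) ℚ) :=
      CyclotomicField.isCyclotomicExtension (cycLevel 3 0 r) ℚ
    have he : w₀.1.asIdeal.ramificationIdx (𝓞 ℚ) = 1 :=
      Kw.ramificationIdx_eq_one_of_isCyclotomicExtension (w := w₀) (cycLevel 3 0 r) hm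
    obtain ⟨hsub, h0, hunit⟩ := clause_d_unit_package_tame' (cycLevel 3 0 r) hm w₀ W hadd ht
    refine ⟨_, hsub, h0, hunit, ?_⟩
    intro dw hinjw hexw hresw z ℓ hℓ
    obtain ⟨Q, hQ, rfl⟩ := hℓ
    exact hDualTame W htow hadd ht P hN hlat d hinj hex hdual r w₀ he dw hinjw hexw hresw z Q hQ

end Summit.BirchSwinnertonDyer.BirchSwinnertonDyer.Theorems.KimAtThreeFineKatoTwoExpHLog

end
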